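import Summits.QuantumFields.YangMills.Theorems.BalabanUVNodesN27AtBothPinsOfRecord13CoPHVCut
import Summits.QuantumFields.YangMills.Theorems.BalabanUVNodesN27AtKernelPinnedReading13CoPHProducers
import Summits.QuantumFields.YangMills.Theorems.BalabanUVNodesN21ShellSplitOfRecord13CoPHKeyed
import Summits.QuantumFields.YangMills.Theorems.BalabanUVNodesN20CoreEdgeAtShellSplitOfRecordFibre

/-!
# BalabanUVNodes ∕ N27 = binder B5 AT THE RECORD — **BOTH v3 PINS, EVERY SLOT IN ITS PRODUCER'S DEEPEST LANDED CURRENCY**: B5 on the live line with the RATE reading pinned to the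
# kernel objects of record (dag-n27-w1 (Kᴾ) `…N27AtKernelPinnedReading13CoPHProducers` §2 `spine_rec13CCoPHOn_holder_of_kernels_pin_of_windowed_member`, 02:10Z 2026-08-28: N22 ⟸
# WINDOWED history-NE9 + `PolLimitExists`, N18 ⟸ NE5 at one member + `ω ≤ θ₅`, (D4) ⟸ (5.10) of record + letter rows, N17 ELIMINATED) AND the SPINE reading pinned at the per-tuple-cut
# physical-volume reading WITH dag-n21-d's SHELL SPLIT OF RECORD (N21 ⟸ (M1) rows p593341, N19′ ⟸ dag-n20-w3's POLICY-FREE lowered FIBRE sandwich (`…N20CoreEdgeAtShellSplitOfRecordFibre`, 02:21Z), N20 a keyed witness, N27x ∕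
# (H-U) ∕ `0 ≤ ζ` theorems) — what K3⁷ v3 REDUCES TO, row by row, at `(𝔯 pinned by U3PinnedKernels, jc, sh := shellSplitOfRecord₁₃At)` on the live line
# (cell `pub-ymgap`, HUMAN RULING D-0062 Track A, R134 seat `pub-ymgap-dag-n27-c` (N27 B5 composite, s2) gen 12; K3⁷ `SpineGivenEndpointR13SepCoPH` = stmt-QuantumFields-20544 (plan g81
# skeleton v3 02f6f498332fdbee); `--kind proof --supports 20544 --as helper`; COUNT-NEUTRAL; ONE theorem, 0 `def`, 0 `sorry`; `N`-generic, `K₀`-generic, live-regime-generic, NO Theses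
# import — the item face is leaf `…N27SpineGivenEndpointR13SepCoPHBothPinsOfRecordVProducers`)

WHAT IS KERNEL-CHECKED ([bookkeeping]; ONE application of (Kᴾ) §2 at the per-tuple-cut reading with the split of record, the four K5 slots filled per tuple by UC §0, n20-d's transfers,
dag-n21-d's keyed face and dag-n20-w3's policy-free fibre face).
★★★ `spine_rec13CCoPHOn_live_of_kernels_pin_producers_at_shellSplitOfRecord₁₃VAt_cut_producers` — B5 at the record class of `G ∧ LiveSel` from EXACTLY these displayed rows:
the pin `hpin` (= `U3PinnedKernels 𝔯 ℓ`); N14 ∕ N15 ∕ N16-at-β as SENTENCES at `RRec₁₃CoPHOn 𝔯 (G ∧ LiveSel)` (their producers knit them one level up: leaves T1∕T2, n15-d, n16-e); the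
letter rows `Signs`, `0 < κ`, `betaPrime510 4 1 κ ≤ cr`, `ω ≤ θ₅`; `hlim` (`PolLimitExists` of the merged term family at every windowed history); `hK` (WINDOWED history-NE9 of the
(1.20)-type kernels of record); `h5` (NE5 at one member of `EA k ∕ EB k b₀`); `hdec` (print's (5.10) clause `KernelDecayOfRecord₁₃ F N θ 0 1 κ`); the one law `hζm`; N20 as a keyed
`RelWeightBound` witness; dag-n21-d's N21 rows (`hρA hρB hM1`); dag-n20-w3's N19′ rows (`hR hερ` and `h19` — the policy-free FIBRE sandwich; `0 < θ.τ9.M` supplied from `Admissible` = GIVEN K4's R-β rates `∀ k, RatesHolderAt … β` at the pinned bundle, a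
summable `δ` with the lowered FIBRE sandwich — no policy letter) ⇒ `Spine` at `IsRecordOfRecord₁₃CCoPHOn F N (G ∧ LiveSel)`.  At `N = 2`, `G :=` the item's guard, `K₀ = 0`: v3's stub 1 ∧ stub 2 AT
THEIR PINS, every conjunct in its producer's words.
Consumed BY NAME: dag-n27-w1 (Kᴾ) (and through it (K) p594329, dag-n22-w3 `n22At_u3OfRecord₁₃_objectsOfRecord₁₃_of_windowed` p593053, dag-n18-w1 `n18At_…_of_n22At_of_member` p593165,
g0 `readOutAt_objectsOfRecord₁₃_coPH` p591653, dag-n17-a); UC §0; dag-n20-d p590105 transfers; dag-n21-d p593341; dag-n20-w3 `…Fibre` (02:21Z); node00-def-K0c `localBgMeasurable`; dag-n20-w2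
`zeta_nonneg_of_provisos₁₃CoPH`.  Nothing landed is edited or re-declared.

HONEST FRAMING.  A REDUCTION, not a discharge: every displayed row is a HYPOTHESIS inhabited for no family today (K0⁷ `Record13SepCoPHInhabited` OPEN) — (5.10) for the limiting
(1.21) kernels (print's claim, NOT proved at these objects), windowed NE9 ∕ `PolLimitExists` ∕ NE5 (the (α)→(β′)→(β) walk is the n22∕n18 lanes' estimate content), NE1′ ∕ NE2 ∕ NE3-at-β
sentences, the FIBRE sandwich (N19's NE7 core at the record; v1.1 wording, ref-D READ 366 NIT), (M1) per top cube, the N20 witness — none PRINTED as used here for d = 4, none proved; `jc ρA ρB ℓ 𝔯 β` FREE (no reading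
minted); nothing of Bałaban's asserted or instantiated; N14–N22 ∕ N27 NOT discharged (the chair books, R417); K3⁷ OPEN, NOT claimed; skeleton v3 untouched; counts UNMOVED (typed 28∕28 ·
discharged 5∕27, A 5∕28); one finite four-torus programme at fixed `ε` — NOT ℝ⁴, NOT infinite volume, NOT OS, NOT a mass gap, NOT Clay.  No decl below carries a cite tag.
-/

set_option autoImplicit false

noncomputable section

namespace Summit.QuantumFields.YangMills.Theorems.BalabanUVNodesN27SpineRecord

open Filter
open scoped BigOperators Matrix.Norms.L2Operator
open MeasureTheory
open Literature.MathematicalPhysics.QuantumFieldTheory.Balaban1983to89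
open Literature.MathematicalPhysics.QuantumFieldTheory.Balaban1983to89.T4Continuum
open Literature.MathematicalPhysics.QuantumFieldTheory.Balaban1983to89.Node00
open Literature.MathematicalPhysics.QuantumFieldTheory.Balaban1983to89.T4OutputRate (Window NE5)
open Literature.MathematicalPhysics.QuantumFieldTheory.Balaban1983to89.B12Sec2to5 (betaPrime510 l1)
open Literature.MathematicalPhysics.QuantumFieldTheory.Balaban1983to89.Node00.U3OfKernels (histPrefix objectsOfRecord₁₃ KernelDecayOfRecord₁₃)
open T4WeightBudget (RelWeightBound)
open T4IndicatorShell (ShellWeightBound)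
open T4ContinuumYM4Torus (ForSmallCouplings)
open Summit.QuantumFields.BalabanUV.T4Continuum.Spine
open YMDAG.UVSplit
open Summit.QuantumFields.YangMills.BalabanUVNodes.N19TargetClassWeightsE1Keyed
open Summit.QuantumFields.YangMills.BalabanUVNodes.N16HolderDefs (S_N16Holder)
open Summit.QuantumFields.YangMills.BalabanUVNodes.SpineRatesHolder (RatesHolderAt)
open Summit.QuantumFields.YangMills.Theorems.N21ShellSplitOfRecord13CoPH (WidthLetter₁₃CoPH shellSplitOfRecord₁₃At shellA₁₃ shellB₁₃ shellPieceOfDatum₉ cubeWeightOfDatum₉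
  shellWeightBound_classSet₁₃_of_cubeAC integrable_topPieceA_of_liveSel integrable_topPieceB_of_liveSel)
open Summit.QuantumFields.YangMills.BalabanUVNodes.N21KeyedShellWeightShellZero (zeta_nonneg_of_provisos₁₃CoPH)
open Summit.QuantumFields.YangMills.BalabanUVNodes.N20CoreEdgeAtShellSplitFibre (core_crOfRecord₁₃VAt_shellSplit_of_loweredFibre_liveSel)

variable {N : ℕ} [NeZero N] (K₀ : ℕ)
  (jc : (F : T4Family) → (θ : Stage13HParams F N) → θ.Provisos₁₃CoPH F N → (ℕ → ℝ) → List (ULoop F) → ℕ → ℕ)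
  (ρA ρB : WidthLetter₁₃CoPH N) (G : (F : T4Family) → Stage13HParams F N → Prop)
  (β : ℝ) (𝔯 : RateReading₁₃CoPH N) (ℓ : (F : T4Family) → Stage13HParams F N → U3Letters₁₁)

open Classical in
/-- ★★★ **B5 ON THE LIVE LINE OF `G` WITH BOTH v3 PINS, EVERY SLOT IN PRODUCER CURRENCY** ((Kᴾ) §2 at `cr := fun F θ hP g₀ os ↦ crOfRecord₁₃VAt K₀ (jc F θ hP g₀ os)
(shellSplitOfRecord₁₃At N K₀ ρA ρB) F θ hP g₀ os`, `Rg := G ∧ LiveSel`; N20 ⟸ keyed witness via `relWeightBound_crOfRecord₁₃VAt`; N21 ⟸ dag-n21-d `shellWeightBound_classSet₁₃_of_cubeAC` +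
§6 live (e1); N27x ⟸ UC §0; N19′ ⟸ dag-n20-w3 `core_crOfRecord₁₃VAt_shellSplit_of_loweredFibre_liveSel` (policy-free fibre road) given the R-β rates at the pinned bundle; (H-U) ∕ `0 ≤ ζ` ⟸ K0c ∕ n20-w2).  Every
displayed row a HYPOTHESIS (0∕1 today); (5.10), windowed NE9, NE5, the sandwich and (M1) NOT proved. [bookkeeping] -/
theorem spine_rec13CCoPHOn_live_of_kernels_pin_producers_at_shellSplitOfRecord₁₃VAt_cut_producers
    (hpin : ∀ (F : T4Family) (θ : Stage13HParams F N) (hP : θ.Provisos₁₃CoPH F N) (g₀ : ℕ → ℝ) (os : List (ULoop F)),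
      (𝔯.lit F θ hP g₀ os).u3 = objectsOfRecord₁₃ F N θ.toStage13Params (ℓ F θ))
    (h14 : S_N14 (RRec₁₃CoPHOn 𝔯 fun F θ => (G F θ ∧ θ.ppSel = ppSelLiveOfRecord F N θ.ν θ.τ9 (EOfRecord₁₃ F N θ.toStage13Params) (wOfRecord₉ F N θ.toStage9Params))))
    (h15 : S_N15 (RRec₁₃CoPHOn 𝔯 fun F θ => (G F θ ∧ θ.ppSel = ppSelLiveOfRecord F N θ.ν θ.τ9 (EOfRecord₁₃ F N θ.toStage13Params) (wOfRecord₉ F N θ.toStage9Params))))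
    (h16 : S_N16Holder β (RRec₁₃CoPHOn 𝔯 fun F θ => (G F θ ∧ θ.ppSel = ppSelLiveOfRecord F N θ.ν θ.τ9 (EOfRecord₁₃ F N θ.toStage13Params) (wOfRecord₉ F N θ.toStage9Params))))
    (hs : ∀ (F : T4Family) (θ : Stage13HParams F N), θ.Provisos₁₃CoPH F N →
      (G F θ ∧ θ.ppSel = ppSelLiveOfRecord F N θ.ν θ.τ9 (EOfRecord₁₃ F N θ.toStage13Params) (wOfRecord₉ F N θ.toStage9Params)) → θ.Admissible F N → (ℓ F θ).Signs)
    (hκ : ∀ (F : T4Family) (θ : Stage13HParams F N), θ.Provisos₁₃CoPH F N →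
      (G F θ ∧ θ.ppSel = ppSelLiveOfRecord F N θ.ν θ.τ9 (EOfRecord₁₃ F N θ.toStage13Params) (wOfRecord₉ F N θ.toStage9Params)) → θ.Admissible F N → 0 < (ℓ F θ).κ)
    (hcr : ∀ (F : T4Family) (θ : Stage13HParams F N), θ.Provisos₁₃CoPH F N →
      (G F θ ∧ θ.ppSel = ppSelLiveOfRecord F N θ.ν θ.τ9 (EOfRecord₁₃ F N θ.toStage13Params) (wOfRecord₉ F N θ.toStage9Params)) → θ.Admissible F N → betaPrime510 4 1 (ℓ F θ).κ ≤ (ℓ F θ).cr)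
    (hωθ : ∀ (F : T4Family) (θ : Stage13HParams F N), θ.Provisos₁₃CoPH F N →
      (G F θ ∧ θ.ppSel = ppSelLiveOfRecord F N θ.ν θ.τ9 (EOfRecord₁₃ F N θ.toStage13Params) (wOfRecord₉ F N θ.toStage9Params)) → θ.Admissible F N → (ℓ F θ).ω ≤ (ℓ F θ).θ₅)
    (hlim : ∀ (F : T4Family) (θ : Stage13HParams F N), θ.Provisos₁₃CoPH F N →
      (G F θ ∧ θ.ppSel = ppSelLiveOfRecord F N θ.ν θ.τ9 (EOfRecord₁₃ F N θ.toStage13Params) (wOfRecord₉ F N θ.toStage9Params)) → θ.Admissible F N →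
      letI := θ.instVβ₁; letI := θ.instVβ₂; letI := θ.instιβ
      ∀ g ∈ Window θ.γ, ∀ j : ℕ,
        PolLimitExists F (j + 1)
          (fun K => mergedTermFamilyMatT F N (TβOfRecord₁₃ F N) (chiβOfRecord₁₃ F N θ.toStage13Params) θ.εbg j (histPrefix g j) K) θ.ρ8 θ.bV)
    (hK : ∀ (F : T4Family) (θ : Stage13HParams F N), θ.Provisos₁₃CoPH F N →
      (G F θ ∧ θ.ppSel = ppSelLiveOfRecord F N θ.ν θ.τ9 (EOfRecord₁₃ F N θ.toStage13Params) (wOfRecord₉ F N θ.toStage9Params)) → θ.Admissible F N →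
      letI := θ.instVβ₁; letI := θ.instVβ₂; letI := θ.instιβ
      ∀ g ∈ Window θ.γ, ∀ g' ∈ Window θ.γ, ∀ (j : ℕ) (μ ν : Fin 4) (z : Fin 4 → ℤ), ∀ᶠ K in atTop,
        |polWindow F K (j + 1)
              (mergedTermFamilyMatT F N (TβOfRecord₁₃ F N) (chiβOfRecord₁₃ F N θ.toStage13Params) θ.εbg j (histPrefix g j) K) θ.ρ8 θ.bV μ ν z -
            polWindow F K (j + 1)
              (mergedTermFamilyMatT F N (TβOfRecord₁₃ F N) (chiβOfRecord₁₃ F N θ.toStage13Params) θ.εbg j (histPrefix g' j) K) θ.ρ8 θ.bV μ ν z| ≤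
          Real.exp (-((ℓ F θ).κ * l1 z)) * ∑ i ∈ Finset.range (j + 1), (ℓ F θ).moduli (j + 1) i * |g i - g' i|)
    (h5 : ∀ (F : T4Family) (θ : Stage13HParams F N), θ.Provisos₁₃CoPH F N →
      (G F θ ∧ θ.ppSel = ppSelLiveOfRecord F N θ.ν θ.τ9 (EOfRecord₁₃ F N θ.toStage13Params) (wOfRecord₉ F N θ.toStage9Params)) → θ.Admissible F N → ∀ k : ℕ, ∃ b₀ : ℝ, 0 < b₀ ∧ b₀ ≤ θ.γ ∧
      NE5 ((objectsOfRecord₁₃ F N θ.toStage13Params (ℓ F θ)).EA k) ((objectsOfRecord₁₃ F N θ.toStage13Params (ℓ F θ)).EB k b₀) (Window θ.γ) (ℓ F θ).κ (ℓ F θ).θ₅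
        ((ℓ F θ).C₅ - (ℓ F θ).C₉ * θ.γ))
    (hdec : ∀ (F : T4Family) (θ : Stage13HParams F N), θ.Provisos₁₃CoPH F N →
      (G F θ ∧ θ.ppSel = ppSelLiveOfRecord F N θ.ν θ.τ9 (EOfRecord₁₃ F N θ.toStage13Params) (wOfRecord₉ F N θ.toStage9Params)) → θ.Admissible F N → KernelDecayOfRecord₁₃ F N θ.toStage13Params 0 1 (ℓ F θ).κ)
    (hζm : ∀ (F : T4Family) (θ : Stage13HParams F N), θ.Provisos₁₃CoPH F N →
      (G F θ ∧ θ.ppSel = ppSelLiveOfRecord F N θ.ν θ.τ9 (EOfRecord₁₃ F N θ.toStage13Params) (wOfRecord₉ F N θ.toStage9Params)) → θ.Admissible F N → ZetaMeasurable F N θ.ζ)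
    (h20 : ∀ (F : T4Family) (θ : Stage13HParams F N) (hP : θ.Provisos₁₃CoPH F N),
      (G F θ ∧ θ.ppSel = ppSelLiveOfRecord F N θ.ν θ.τ9 (EOfRecord₁₃ F N θ.toStage13Params) (wOfRecord₉ F N θ.toStage9Params)) → θ.Admissible F N →
        ∀ (g₀ : ℕ → ℝ) (os : List (ULoop F)),
          ∃ W : ℕ → ℝ, RelWeightBound 1 (classSet₁₃ θ K₀ g₀) (weightA₁₃ θ hP K₀ g₀ os) (weightB₁₃ θ hP K₀ g₀ os) (badClass₁₃ θ K₀ g₀ (jc F θ hP g₀ os)) W)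
    (hρA : ∀ (F : T4Family) (θ : Stage13HParams F N) (hP : θ.Provisos₁₃CoPH F N),
      (G F θ ∧ θ.ppSel = ppSelLiveOfRecord F N θ.ν θ.τ9 (EOfRecord₁₃ F N θ.toStage13Params) (wOfRecord₉ F N θ.toStage9Params)) → θ.Admissible F N →
        ∀ (g₀ : ℕ → ℝ) (os : List (ULoop F)) (K : ℕ), 0 ≤ ρA F θ hP g₀ os K)
    (hρB : ∀ (F : T4Family) (θ : Stage13HParams F N) (hP : θ.Provisos₁₃CoPH F N),
      (G F θ ∧ θ.ppSel = ppSelLiveOfRecord F N θ.ν θ.τ9 (EOfRecord₁₃ F N θ.toStage13Params) (wOfRecord₉ F N θ.toStage9Params)) → θ.Admissible F N →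
        ∀ (g₀ : ℕ → ℝ) (os : List (ULoop F)) (K : ℕ), 0 ≤ ρB F θ hP g₀ os K)
    (hM1 : ∀ (F : T4Family) (θ : Stage13HParams F N) (hP : θ.Provisos₁₃CoPH F N),
      (G F θ ∧ θ.ppSel = ppSelLiveOfRecord F N θ.ν θ.τ9 (EOfRecord₁₃ F N θ.toStage13Params) (wOfRecord₉ F N θ.toStage9Params)) → θ.Admissible F N →
        ∀ (g₀ : ℕ → ℝ) (os : List (ULoop F)), ∃ DA DB : ℕ → ℝ, (∀ K, 0 ≤ DA K) ∧ (∀ K, 0 ≤ DB K) ∧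
          Summable (fun K => DA K * ρA F θ hP g₀ os K) ∧ Summable (fun K => DB K * ρB F θ hP g₀ os K) ∧
          (∀ (K : ℕ) (t : ℝ), |t| ≤ 1 →
            ∀ a : ↥(cubeIndices (F.P (K₀ + K)) (cubeSide (F.P (K₀ + K)).L θ.ν.M₂ (RkOfRecord (F.P (K₀ + K)).L θ.ν.r (histA₁₃ θ K₀ g₀ K (K₀ + K))) (K₀ + K))),
              ∑ s, shellPieceOfDatum₉ F N θ.toStage9Params (datumOfRecord₁₃CoPH F N θ hP) g₀ os (runA₁₃ F K₀ g₀ K) (histA₁₃ θ K₀ g₀ K) (K₀ + K)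
                  (ρA F θ hP g₀ os K) t a s ≤
                (DA K * ρA F θ hP g₀ os K) *
                  ∑ s, cubeWeightOfDatum₉ F N θ.toStage9Params (datumOfRecord₁₃CoPH F N θ hP) g₀ os (runA₁₃ F K₀ g₀ K) (histA₁₃ θ K₀ g₀ K) (K₀ + K) t a s) ∧
          (∀ (K : ℕ) (t : ℝ), |t| ≤ 1 →
            ∀ a : ↥(cubeIndices (F.P (K₀ + K + 1)) (cubeSide (F.P (K₀ + K + 1)).L θ.ν.M₂
                (RkOfRecord (F.P (K₀ + K + 1)).L θ.ν.r (histB₁₃ θ K₀ g₀ K (K₀ + K + 1))) (K₀ + K + 1))),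
              ∑ s', shellPieceOfDatum₉ F N θ.toStage9Params (datumOfRecord₁₃CoPH F N θ hP) g₀ os (runB₁₃ F K₀ g₀ K) (histB₁₃ θ K₀ g₀ K) (K₀ + K + 1)
                  (ρB F θ hP g₀ os K) t a s' ≤
                (DB K * ρB F θ hP g₀ os K) *
                  ∑ s', cubeWeightOfDatum₉ F N θ.toStage9Params (datumOfRecord₁₃CoPH F N θ hP) g₀ os (runB₁₃ F K₀ g₀ K) (histB₁₃ θ K₀ g₀ K) (K₀ + K + 1) t a s'))
    (hR : ∀ (F : T4Family) (θ : Stage13HParams F N) (hP : θ.Provisos₁₃CoPH F N), (G F θ ∧ θ.ppSel = ppSelLiveOfRecord F N θ.ν θ.τ9 (EOfRecord₁₃ F N θ.toStage13Params) (wOfRecord₉ F N θ.toStage9Params)) → θ.Admissible F N →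
      ∀ (g₀ : ℕ → ℝ) (K : ℕ), RAgree F θ.ν (histA₁₃ θ K₀ g₀ K) (histB₁₃ θ K₀ g₀ K) (K₀ + K))
    (hερ : ∀ (F : T4Family) (θ : Stage13HParams F N) (hP : θ.Provisos₁₃CoPH F N), (G F θ ∧ θ.ppSel = ppSelLiveOfRecord F N θ.ν θ.τ9 (EOfRecord₁₃ F N θ.toStage13Params) (wOfRecord₉ F N θ.toStage9Params)) → θ.Admissible F N →
      ∀ (g₀ : ℕ → ℝ) (os : List (ULoop F)) (K : ℕ), 0 ≤ epsOfRecord θ.ν (histA₁₃ θ K₀ g₀ K) (K₀ + K) * ρA F θ hP g₀ os K ∧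
        0 ≤ epsOfRecord θ.ν (histB₁₃ θ K₀ g₀ K) (K₀ + K + 1) * ρB F θ hP g₀ os K)
    (h19 : ∀ (F : T4Family) (θ : Stage13HParams F N) (hP : θ.Provisos₁₃CoPH F N) (hRg : (G F θ ∧ θ.ppSel = ppSelLiveOfRecord F N θ.ν θ.τ9 (EOfRecord₁₃ F N θ.toStage13Params) (wOfRecord₉ F N θ.toStage9Params))) (hθ : θ.Admissible F N)
      (g₀ : ℕ → ℝ) (os : List (ULoop F)), (∀ k : ℕ, RatesHolderAt (datumOfRecord₁₃CoPH F N θ hP) (rateCarriersOfRecord₁₃CoPH 𝔯 F θ hP g₀ os k) β) →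
        ∃ δ : ℕ → ℝ, Summable δ ∧ ∀ K : ℕ, ∃ c : ℝ, ∀ t : ℝ, |t| ≤ 1 → ∀ s : SeqOfRecord F θ.ν θ.τ9.M (histA₁₃ θ K₀ g₀ K) (K₀ + K) (K₀ + K),
          (⟨K, twoRunKeyA F θ.ν θ.τ9.M (histA₁₃ θ K₀ g₀ K) (K₀ + K) (K₀ + K) s⟩ : Σ K, SiteSeqKey F (K₀ + K)) ∉ badClass₁₃ θ K₀ g₀ (jc F θ hP g₀ os) K t →
          Real.exp (c - F.side ^ 4 * δ K) *
                (∫ V, chiSeqOfRecordAt F N θ.ν θ.τ9.M (histA₁₃ θ K₀ g₀ K) (K₀ + K) (K₀ + K)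
                        (epsOfRecord θ.ν (histA₁₃ θ K₀ g₀ K) (K₀ + K) * (1 - ρA F θ hP g₀ os K)) s V *
                      dressedSlotsOfDatum₉ F N θ.toStage9Params (datumOfRecord₁₃CoPH F N θ hP) g₀ os t (runA₁₃ F K₀ g₀ K) (histA₁₃ θ K₀ g₀ K) (K₀ + K) s V
                      ∂fieldMeasure (F.P (K₀ + K)) (K₀ + K) (Node00.SU N))
            ≤ ∑ s' ∈ Finset.univ.filter (fun s' : SeqOfRecord F θ.ν θ.τ9.M (histB₁₃ θ K₀ g₀ K) (K₀ + K + 1) (K₀ + K + 1) => truncSeq F θ.ν hθ.toStage9.2.2.2 (hR F θ hP hRg hθ g₀ K) s' = s),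
                (∫ V, chiSeqOfRecordAt F N θ.ν θ.τ9.M (histB₁₃ θ K₀ g₀ K) (K₀ + K + 1) (K₀ + K + 1)
                        (epsOfRecord θ.ν (histB₁₃ θ K₀ g₀ K) (K₀ + K + 1) * (1 - ρB F θ hP g₀ os K)) s' V *
                      dressedSlotsOfDatum₉ F N θ.toStage9Params (datumOfRecord₁₃CoPH F N θ hP) g₀ os t (runB₁₃ F K₀ g₀ K) (histB₁₃ θ K₀ g₀ K) (K₀ + K + 1) s' V
                      ∂fieldMeasure (F.P (K₀ + K + 1)) (K₀ + K + 1) (Node00.SU N)) ∧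
          ∑ s' ∈ Finset.univ.filter (fun s' : SeqOfRecord F θ.ν θ.τ9.M (histB₁₃ θ K₀ g₀ K) (K₀ + K + 1) (K₀ + K + 1) => truncSeq F θ.ν hθ.toStage9.2.2.2 (hR F θ hP hRg hθ g₀ K) s' = s),
                (∫ V, chiSeqOfRecordAt F N θ.ν θ.τ9.M (histB₁₃ θ K₀ g₀ K) (K₀ + K + 1) (K₀ + K + 1)
                        (epsOfRecord θ.ν (histB₁₃ θ K₀ g₀ K) (K₀ + K + 1) * (1 - ρB F θ hP g₀ os K)) s' V *
                      dressedSlotsOfDatum₉ F N θ.toStage9Params (datumOfRecord₁₃CoPH F N θ hP) g₀ os t (runB₁₃ F K₀ g₀ K) (histB₁₃ θ K₀ g₀ K) (K₀ + K + 1) s' V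
                      ∂fieldMeasure (F.P (K₀ + K + 1)) (K₀ + K + 1) (Node00.SU N))
            ≤ Real.exp (c + F.side ^ 4 * δ K) *
                (∫ V, chiSeqOfRecordAt F N θ.ν θ.τ9.M (histA₁₃ θ K₀ g₀ K) (K₀ + K) (K₀ + K)
                        (epsOfRecord θ.ν (histA₁₃ θ K₀ g₀ K) (K₀ + K) * (1 - ρA F θ hP g₀ os K)) s V *
                      dressedSlotsOfDatum₉ F N θ.toStage9Params (datumOfRecord₁₃CoPH F N θ hP) g₀ os t (runA₁₃ F K₀ g₀ K) (histA₁₃ θ K₀ g₀ K) (K₀ + K) s V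
                      ∂fieldMeasure (F.P (K₀ + K)) (K₀ + K) (Node00.SU N))) :
    Spine (N := N) fun F D w => Node00.IsRecordOfRecord₁₃CCoPHOn F N (fun F θ => (G F θ ∧ θ.ppSel = ppSelLiveOfRecord F N θ.ν θ.τ9 (EOfRecord₁₃ F N θ.toStage13Params) (wOfRecord₉ F N θ.toStage9Params))) D w :=
  spine_rec13CCoPHOn_holder_of_kernels_pin_of_windowed_member
    (fun F θ hP g₀ os => crOfRecord₁₃VAt K₀ (jc F θ hP g₀ os) (shellSplitOfRecord₁₃At N K₀ ρA ρB) F θ hP g₀ os) β 𝔯 (fun F θ => (G F θ ∧ θ.ppSel = ppSelLiveOfRecord F N θ.ν θ.τ9 (EOfRecord₁₃ F N θ.toStage13Params) (wOfRecord₉ F N θ.toStage9Params))) ℓ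
    hpin h14 h15 h16 hs hκ hcr hωθ hlim hK h5 hdec
    ((s_N20_sRec₁₃CoPHOn_iff (fun F θ hP g₀ os => crOfRecord₁₃VAt K₀ (jc F θ hP g₀ os) (shellSplitOfRecord₁₃At N K₀ ρA ρB) F θ hP g₀ os) _).mpr
      fun F θ hP hRg hθ g₀ os => by
        obtain ⟨W, hW⟩ := h20 F θ hP hRg hθ g₀ os
        exact relWeightBound_crOfRecord₁₃VAt K₀ (jc F θ hP g₀ os) _ θ hP g₀ os hW)
    (by
      rintro F D g₀ os S ⟨θ, hP, hRg, hθ, -, rfl⟩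
      obtain ⟨DA, DB, hDA, hDB, hsA, hsB, hM1A, hM1B⟩ := hM1 F θ hP hRg hθ g₀ os
      exact shellWeightBound_crOfRecord₁₃VAt K₀ (jc F θ hP g₀ os) _ θ hP g₀ os
        (shellWeightBound_classSet₁₃_of_cubeAC K₀ θ hP g₀ os (localBgMeasurable F N θ.ν) (zeta_nonneg_of_provisos₁₃CoPH F θ hP)
          (fun K t s => integrable_topPieceA_of_liveSel K₀ θ hP _ hRg.2 (localBgMeasurable F N θ.ν) (hζm F θ hP hRg hθ)
            (zeta_nonneg_of_provisos₁₃CoPH F θ hP) g₀ os K t s)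
          (fun K t s' => integrable_topPieceB_of_liveSel K₀ θ hP _ hRg.2 (localBgMeasurable F N θ.ν) (hζm F θ hP hRg hθ)
            (zeta_nonneg_of_provisos₁₃CoPH F θ hP) g₀ os K t s')
          (hρA F θ hP hRg hθ g₀ os) hDA (hρB F θ hP hRg hθ g₀ os) hDB hsA hsB hM1A hM1B))
    (fun F θ hP hRg hθ _ _ =>
      keyedExtraction_crOfRecord₁₃VAt_cut K₀ jc _ θ hP _ hRg.2 (localBgMeasurable F N θ.ν) (hζm F θ hP hRg hθ) (zeta_nonneg_of_provisos₁₃CoPH F θ hP))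
    (fun F θ hP hRg hθ g₀ os hk => by
      letI : DecidableEq (Σ K, SiteSeqKey F (K₀ + K)) := Classical.decEq _
      obtain ⟨δ, hδ, hlow⟩ := h19 F θ hP hRg hθ g₀ os hk
      exact ⟨_, core_crOfRecord₁₃VAt_shellSplit_of_loweredFibre_liveSel θ hP K₀ g₀ os hθ.toStage9.2.2.2 (hR F θ hP hRg hθ g₀) (jc F θ hP g₀ os) ρA ρB hδ _ hRg.2
        (localBgMeasurable F N θ.ν) (hζm F θ hP hRg hθ) (fun K => (hερ F θ hP hRg hθ g₀ os K).1) (fun K => (hερ F θ hP hRg hθ g₀ os K).2) hlow⟩)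

end Summit.QuantumFields.YangMills.Theorems.BalabanUVNodesN27SpineRecord

end
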